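import Summits.AtomisticToContinuum.Crystallization.Theorems.FrustratedLawDichotomyThinning

/-!
# FrustratedLawDichotomy · crux `AperiodicFrustratedLawGap` (stmt-AtomisticToContinuum-27623) — COVARIANT THICKENING OF LAWS, part 1a:
# thickening (pattern-selected insertion) of rooted hard-core configurations — re-rooting, hard core, measurable version
# (decomp-a2c, prover hand 2, structural share, generation 4)

The DUAL of the covariant thinnings of `FrustratedLawDichotomyThinning`: a third non-affine family of admissible competitors of a
point-stationary law, COVARIANT THICKENINGS (pattern-selected insertions).  Fix a Giry-measurable set `A` of rooted configurations (a
PATTERN) and an offset `u : ℝ³`.  In a rooted configuration `μ` insert a new atom at `p + u` next to every atom `p` whose rooted view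
`θ_p μ` shows the pattern (`θ_p μ ∈ A`):

  `Ins μ = μ + (μ|{p : θ_p μ ∈ A}).map (· + u)`   (rooted at the old root).

Seen from an inserted atom `p + u` the thickened configuration is `θ_u (Ins (θ_p μ))` (`ins_reroot_copy`), seen from an old atom `y` it is
`Ins (θ_y μ)` (`ins_reroot_atom`).  Hence the THICKENED LAW of a law `P` is the two-type mixture

  `P ∘ Ins⁻¹ + (P|A) ∘ (θ_u ∘ Ins)⁻¹`   (total mass `1 + P(A)`),

and its Mecke identity is the sum of FOUR Mecke identities of `P` (payloads `g(Ins μ, y)`, `1_A(μ) g(θ_u Ins μ, y − u)`,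
`1_A(θ_y μ) g(Ins μ, y + u)`, `1_A(μ) 1_A(θ_y μ) g(θ_u Ins μ, y)`), exactly as for the two-copy superposition of
`FrustratedLawDichotomyDoublingStationary` (the case `A` = everything) and the thinnings (indicators swapped by the Mecke involution).

* `ins_reroot_atom`, `ins_reroot_copy` — re-rooting a thickened configuration;
* `isRootedHardCore_ins` — if the inserted sites are `s`-vacant (`s ≤ dist q (p + u)` for all atoms `p, q` with `θ_p μ ∈ A`), the thickened
  configuration of a rooted `δ`-hard-core configuration is a rooted `min δ s`-hard-core configuration (inserted atoms inherit the separation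
  of their parents); `isRootedHardCore_ins_copy` — and so is its re-rooting at the inserted atom `u` when `μ ∈ A`;
* `exists_measurable_ins` — a MEASURABLE version of `Ins` on the Giry space (from the measurable thinning map);
* `isPointStationaryLaw_thickened` — **the thickened law of a point-stationary hard-core law is point-stationary**.

Part 2 (`FrustratedLawDichotomyThickeningStability`): the energy of the thickened law and THICKENING (INSERTION) STABILITY — granted the floor
of item 9229, `(1 + P(A))·e⋆ ≤ E_P[rootEnergy ∘ Ins] + ∫_A rootEnergy(θ_u Ins μ) dP`: a minimising law has no pattern-selected family of
`e⋆`-deep holes (Sütő's one-atom insertion test, law level).  All `[folklore]` (Palm calculus of dependent superpositions).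
-/

noncomputable section

namespace Summit.AtomisticToContinuum.Crystallization.Theorems.FrustratedLawDichotomyThickening

open MeasureTheory Metric Set Filter ProbabilityTheory
open scoped ENNReal Topology BigOperators
open Literature.MathematicalPhysics.StatisticalMechanics Literature.Probability.Process
open Summit.AtomisticToContinuum.Crystallization.Theorems.ChargedEnergyGapNegative (E3 eStar)
open Summit.AtomisticToContinuum.Crystallization.Theorems.BenjaminiSchrammLimit (measurableSet_setOf_isRootedHardCore)
open Summit.AtomisticToContinuum.Crystallization.Theorems.FrustratedLawDichotomyFiniteClusterGap
  (ae_mem_of_sep exists_kernel_eq_count_restrict measurable_kernel_map_sub aemeasurable_lintegral_of_ae_hardCore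
    aemeasurable_lintegral_reroot_of_ae_hardCore measurable_reroot_section map_add_count_restrict)
open Summit.AtomisticToContinuum.Crystallization.Theorems.FrustratedLawDichotomyThinning
  (exists_measurable_thinning thin_reroot map_sub_map_sub map_sub_map_sub_neg)

variable {δ : ℝ} {A : Set (Measure E3)}

/-! ## §1. Thickening a rooted hard-core configuration -/

section Config

/-- **Insertion commutes with re-rooting at an old atom**: `θ_y (Ins μ) = Ins (θ_y μ)` for a rooted hard-core `μ` with measurable pattern set
`{p | θ_p μ ∈ A}` (deletion commutes with re-rooting, `thin_reroot`, and translations commute). [folklore] -/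
theorem ins_reroot_atom {μ : Measure E3} (hμ : IsRootedHardCore δ μ)
    (hK : MeasurableSet {p : E3 | μ.map (fun x : E3 => x - p) ∈ A}) (u y : E3) :
    (μ + (μ.restrict {p : E3 | μ.map (fun x : E3 => x - p) ∈ A}).map (fun z => z + u)).map (fun z => z - y) =
      μ.map (fun z => z - y) +
        ((μ.map (fun z => z - y)).restrict {p : E3 | (μ.map (fun z => z - y)).map (fun x : E3 => x - p) ∈ A}).map (fun z => z + u) := by
  rw [Measure.map_add _ _ (measurable_sub_const y), thin_reroot hμ hK y,
    Measure.map_map (measurable_sub_const y) (measurable_add_const u),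
    Measure.map_map (measurable_add_const u) (measurable_sub_const y)]
  have hcomp : ((fun z : E3 => z - y) ∘ fun z => z + u) = ((fun z : E3 => z + u) ∘ fun z => z - y) := by
    funext z; simp only [Function.comp_apply]; abel
  rw [hcomp]

/-- **Re-rooting at an inserted atom**: `θ_{p+u} (Ins μ) = θ_u (Ins (θ_p μ))`. [folklore] -/
theorem ins_reroot_copy {μ : Measure E3} (hμ : IsRootedHardCore δ μ)
    (hK : MeasurableSet {p : E3 | μ.map (fun x : E3 => x - p) ∈ A}) (u p : E3) :
    (μ + (μ.restrict {p : E3 | μ.map (fun x : E3 => x - p) ∈ A}).map (fun z => z + u)).map (fun z => z - (p + u)) =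
      (μ.map (fun z => z - p) +
        ((μ.map (fun z => z - p)).restrict {q : E3 | (μ.map (fun z => z - p)).map (fun x : E3 => x - q) ∈ A}).map (fun z => z + u)).map
        (fun z => z - u) := by
  rw [← ins_reroot_atom hμ hK u p, map_sub_map_sub, add_comm u p]

/-- **Thickening preserves the hard core when the inserted sites are vacant.**  If `μ` is a rooted `δ`-hard-core configuration (`δ, s > 0`)
and every inserted site `p + u` (`θ_p μ ∈ A`) is at distance `≥ s` from every atom, then `Ins μ` is a rooted `min δ s`-hard-core
configuration: two inserted atoms `p + u, p' + u` are as far apart as their parents. [folklore] -/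
theorem isRootedHardCore_ins (hδ : 0 < δ) {s : ℝ} (hs : 0 < s) {μ : Measure E3} (hμ : IsRootedHardCore δ μ)
    (hK : MeasurableSet {p : E3 | μ.map (fun x : E3 => x - p) ∈ A}) {u : E3}
    (hV : ∀ p q : E3, μ {p} ≠ 0 → μ {q} ≠ 0 → μ.map (fun x : E3 => x - p) ∈ A → s ≤ dist q (p + u)) :
    IsRootedHardCore (min δ s) (μ + (μ.restrict {p : E3 | μ.map (fun x : E3 => x - p) ∈ A}).map (fun z => z + u)) := by
  have hμ' := hμ
  obtain ⟨S, h0, hsep, rfl⟩ := hμ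
  set K : Set E3 := {p : E3 | ((Measure.count : Measure E3).restrict S).map (fun x : E3 => x - p) ∈ A} with hKdef
  have hKS : ∀ p ∈ K ∩ S, ∀ q ∈ S, s ≤ dist q (p + u) := fun p hp q hq =>
    hV p q ((count_restrict_singleton_ne_zero_iff S p).2 hp.2) ((count_restrict_singleton_ne_zero_iff S q).2 hq) hp.1
  have hdisj : Disjoint S ((fun z => z + u) '' (K ∩ S)) := by
    refine Set.disjoint_left.2 fun q hq hq' => ?_
    obtain ⟨p, hp, rfl⟩ := hq'
    have := hKS p hp (p + u) hq
    rw [dist_self] at this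
    exact absurd this (not_le.2 hs)
  have hSm : MeasurableSet S := (Metric.isClosed_of_pairwise_le_dist hδ hsep).measurableSet
  have hTm : MeasurableSet ((fun z : E3 => z + u) '' (K ∩ S)) := by
    have : (fun z : E3 => z + u) '' (K ∩ S) = (fun z : E3 => z - u) ⁻¹' (K ∩ S) := by
      ext z
      constructor
      · rintro ⟨p, hp, rfl⟩
        simpa using hp
      · intro hz
        exact ⟨z - u, hz, by abel⟩
    rw [this]
    exact (measurable_sub_const u) (hK.inter hSm)
  refine ⟨S ∪ (fun z => z + u) '' (K ∩ S), Or.inl h0, ?_, ?_⟩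
  · rintro x (hx | ⟨p, hp, rfl⟩) y (hy | ⟨p', hp', rfl⟩) hxy
    · exact (min_le_left _ _).trans (hsep x hx y hy hxy)
    · exact (min_le_right _ _).trans (hKS p' hp' x hx)
    · rw [dist_comm]; exact (min_le_right _ _).trans (hKS p hp y hy)
    · rw [dist_add_right]
      exact (min_le_left _ _).trans (hsep p hp.2 p' hp'.2 fun h => hxy (by rw [h]))
  · rw [Measure.restrict_restrict hK, map_add_count_restrict, Measure.restrict_union hdisj hTm]

/-- The root is an atom of the pattern set iff the configuration shows the pattern: `0 ∈ {p | θ_p μ ∈ A} ↔ μ ∈ A`. [folklore] -/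
theorem zero_mem_keptSet_iff (μ : Measure E3) : (0 : E3) ∈ {p : E3 | μ.map (fun x : E3 => x - p) ∈ A} ↔ μ ∈ A := by
  simp only [Set.mem_setOf_eq, sub_zero, Measure.map_id']

/-- **The thickened configuration re-rooted at the inserted atom `u`** is a rooted `min δ s`-hard-core configuration when the root shows the
pattern (`μ ∈ A`, so that `u = 0 + u` is inserted). [folklore] -/
theorem isRootedHardCore_ins_copy (hδ : 0 < δ) {s : ℝ} (hs : 0 < s) {μ : Measure E3} (hμ : IsRootedHardCore δ μ)
    (hK : MeasurableSet {p : E3 | μ.map (fun x : E3 => x - p) ∈ A}) {u : E3}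
    (hV : ∀ p q : E3, μ {p} ≠ 0 → μ {q} ≠ 0 → μ.map (fun x : E3 => x - p) ∈ A → s ≤ dist q (p + u)) (hμA : μ ∈ A) :
    IsRootedHardCore (min δ s) ((μ + (μ.restrict {p : E3 | μ.map (fun x : E3 => x - p) ∈ A}).map (fun z => z + u)).map
      (fun z => z - u)) := by
  refine (isRootedHardCore_ins hδ hs hμ hK hV).map_sub ?_
  -- `u` is an inserted atom
  have h0 : μ {0} ≠ 0 := by rw [hμ.measure_zero_singleton]; exact one_ne_zero
  rw [Measure.add_apply]
  refine ne_of_gt (lt_of_lt_of_le ?_ le_add_self)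
  rw [Measure.map_apply (measurable_add_const u) (measurableSet_singleton u), Measure.restrict_apply' hK]
  have hsub : ({0} : Set E3) ⊆ (fun z : E3 => z + u) ⁻¹' {u} ∩ {p : E3 | μ.map (fun x : E3 => x - p) ∈ A} := by
    intro z hz
    rw [Set.mem_singleton_iff.1 hz]
    exact ⟨by simp, (zero_mem_keptSet_iff μ).2 hμA⟩
  exact lt_of_lt_of_le (pos_iff_ne_zero.2 h0) (measure_mono hsub)

/-- The vacancy condition is inherited by re-rooted configurations. [folklore] -/
theorem vacant_reroot {s : ℝ} {μ : Measure E3} (hμ : IsRootedHardCore δ μ) {u : E3}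
    (hV : ∀ p q : E3, μ {p} ≠ 0 → μ {q} ≠ 0 → μ.map (fun x : E3 => x - p) ∈ A → s ≤ dist q (p + u)) {y : E3} (hy : μ {y} ≠ 0) :
    ∀ p q : E3, (μ.map fun x : E3 => x - y) {p} ≠ 0 → (μ.map fun x : E3 => x - y) {q} ≠ 0 →
      (μ.map fun x : E3 => x - y).map (fun x : E3 => x - p) ∈ A → s ≤ dist q (p + u) := by
  obtain ⟨S, h0, hsep, rfl⟩ := hμ
  intro p q hp hq hpA
  rw [map_sub_count_restrict] at hp hq
  obtain ⟨p', hp', rfl⟩ := (count_restrict_singleton_ne_zero_iff _ p).1 hp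
  obtain ⟨q', hq', rfl⟩ := (count_restrict_singleton_ne_zero_iff _ q).1 hq
  rw [map_sub_map_sub, sub_add_cancel] at hpA
  have := hV p' q' ((count_restrict_singleton_ne_zero_iff S p').2 hp') ((count_restrict_singleton_ne_zero_iff S q').2 hq') hpA
  have heq : dist (q' - y) (p' - y + u) = dist q' (p' + u) := by
    rw [show p' - y + u = p' + u - y by abel, dist_sub_right]
  rwa [heq]

/-- **Sums over a thickened configuration**: `Σ_{y ∈ Ins μ} F(y) = Σ_{y ∈ μ} F(y) + Σ_{y ∈ μ, y ∈ K} F(y + u)`. [folklore] -/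
theorem lintegral_ins (μ : Measure E3) {K : Set E3} (hK : MeasurableSet K) (u : E3) {F : E3 → ℝ≥0∞} (hF : Measurable F) :
    ∫⁻ y, F y ∂(μ + (μ.restrict K).map (fun z => z + u)) = ∫⁻ y, F y ∂μ + ∫⁻ y, K.indicator (fun y => F (y + u)) y ∂μ := by
  rw [lintegral_add_measure, lintegral_map hF (measurable_add_const u), ← lintegral_indicator hK]

/-- Splitting a four-term sum over a configuration (bookkeeping). [folklore] -/
theorem lintegral_add₄ (μ : Measure E3) {a b c d : E3 → ℝ≥0∞} (ha : Measurable a) (hb : Measurable b) (hc : Measurable c)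
    (hd : Measurable d) (r : ℝ≥0∞) :
    ∫⁻ y, a y + r * b y + c y + r * d y ∂μ = (∫⁻ y, a y ∂μ) + r * (∫⁻ y, b y ∂μ) + (∫⁻ y, c y ∂μ) + r * ∫⁻ y, d y ∂μ := by
  rw [lintegral_add_left (f := fun y => a y + r * b y + c y) ((ha.add (measurable_const.mul hb)).add hc),
    lintegral_add_left (f := fun y => a y + r * b y) (ha.add (measurable_const.mul hb)), lintegral_add_left ha,
    lintegral_const_mul r hb, lintegral_const_mul r hd]

end Config

/-! ## §2. A measurable version of the thickening map -/

section MeasurableIns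

/-- **A measurable thickening map.**  For `δ > 0`, a measurable pattern `A` and an offset `u` there is a measurable `I : Measure ℝ³ → Measure ℝ³`
with `I μ = μ + (μ|{p | θ_p μ ∈ A}).map (· + u)` for every rooted `δ`-hard-core `μ`, the pattern set being measurable. [folklore] -/
theorem exists_measurable_ins (hδ : 0 < δ) (hA : MeasurableSet A) (u : E3) :
    ∃ I : Measure E3 → Measure E3, Measurable I ∧ ∀ μ : Measure E3, IsRootedHardCore δ μ →
      MeasurableSet {p : E3 | μ.map (fun x : E3 => x - p) ∈ A} ∧
        I μ = μ + (μ.restrict {p : E3 | μ.map (fun x : E3 => x - p) ∈ A}).map (fun z => z + u) := by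
  obtain ⟨T, hTm, hT⟩ := exists_measurable_thinning (G := A) hδ hA
  have hF : Measurable fun μ : Measure E3 => (T μ).map (fun z => z + u) :=
    (Measure.measurable_map _ (measurable_add_const u)).comp hTm
  refine ⟨fun μ => μ + (T μ).map (fun z => z + u), ?_, fun μ hμ => ⟨(hT μ hμ).1, ?_⟩⟩
  · refine Measure.measurable_of_measurable_coe _ fun s hs => ?_
    have heq : (fun μ : Measure E3 => (μ + (T μ).map (fun z => z + u)) s) = fun μ => μ s + ((T μ).map (fun z => z + u)) s := by
      funext μ; rw [Measure.add_apply]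
    rw [heq]
    exact (Measure.measurable_coe hs).add ((Measure.measurable_coe hs).comp hF)
  · dsimp only
    rw [(hT μ hμ).2]

end MeasurableIns

end Summit.AtomisticToContinuum.Crystallization.Theorems.FrustratedLawDichotomyThickening

end
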